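import Summits.Ventures.PercRepro.RankLevelSetTripleMult

/-!
# PercRepro — THE 3-EXCHANGE MULTIPLICITY AT `ν = 3`, PART B: the pair families counted exactly, the `6`-point plane
(p8 g4, S3 §3q)

`proofs/SUBCLAIM-S3-p8.md` §3q. (1) `exists_pair_families`: for a basis `I` of the rank-`q` set `B` (`X = B ∖ I`), the
sets `I ∪ {e}` (`e ∈ X`) and `(I ∖ {z}) ∪ P` (`P` a pair of `X`, `z ∈ I` on the fundamental circuit of an element of
`P`) — p7's square / the triple — are `|X| + Σ_P |{z ∈ I : z ∈ C(e, I), e ∈ P}|` distinct spanning `(q+1)`-subsets,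
each containing all of `I` but at most one element (the count is kept exactly, not bounded below). (2) Under the line
bound (every rank-`2` set has `≤ 3` points; every circuit `≥ 3` elements) a `4`-subset `A` of a set `W ⊆ cl(U)`, `U`
independent of `3` elements, has `U` in its closure — a basis of `A` with `≤ 1` element would put a circuit of `≤ 2`
elements in `A`, one with `2` elements would make `A` a `4`-point line (`subset_closure_of_four_subset`); hence
(`exists_plane_family`) when `|B ∖ I| = 3`, `U ⊆ I` has `3` elements and `B ∖ I ⊆ cl(U)`, the `C(6, 4) = 15` sets
`(I ∖ U) ∪ A`, `A` a `4`-subset of the `6`-point plane `U ∪ (B ∖ I)`, are distinct spanning `(q+1)`-subsets of `B`.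
Part A (RankLevelSetMultFifteenA) is the 3-exchange family; RankLevelSetMultFifteen assembles `card_spanF_ge_fifteen`.
Axioms: standard.
-/

open scoped Matroid

namespace PercRepro

namespace S2

open Set Finset

variable {α : Type} {M : Matroid α}

/-- **FOUR POINTS OF A PLANE SPAN IT**: under the line bound (every rank-`2` set has `≤ 3` points; every circuit
`≥ 3` elements), a `4`-subset `A` of a set `W ⊆ cl(U)`, `U` independent of `3` elements, has `U` in its closure — a
basis `J` of `A` has `≤ 3` elements; `≤ 1` would put a circuit of `≤ 2` elements inside `A`, `2` would make `A` a
`4`-point line, so `J` has `3` elements and is a basis of `cl(U)`. -/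
theorem subset_closure_of_four_subset [M.Finite] (hcirc : ∀ C, M.IsCircuit C → 3 ≤ C.encard)
    (hline : ∀ L ⊆ M.E, M.eRk L = 2 → L.ncard ≤ 3)
    {U : Finset α} (hU : M.Indep (U : Set α)) (hU3 : U.card = 3)
    {W : Finset α} (hWE : (W : Set α) ⊆ M.E) (hWcl : (W : Set α) ⊆ M.closure (U : Set α))
    {A : Finset α} (hAW : A ⊆ W) (hA4 : A.card = 4) :
    (U : Set α) ⊆ M.closure (A : Set α) := by
  classical
  have hAE : (A : Set α) ⊆ M.E := (Finset.coe_subset.2 hAW).trans hWE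
  have hAcl : (A : Set α) ⊆ M.closure (U : Set α) := (Finset.coe_subset.2 hAW).trans hWcl
  obtain ⟨J, hJ⟩ := M.exists_isBasis (A : Set α) hAE
  have hJfin : J.Finite := A.finite_toSet.subset hJ.subset
  have hJA : J ⊆ (A : Set α) := hJ.subset
  have hJind : M.Indep J := hJ.indep
  have hJencard : J.encard = M.eRk (A : Set α) := hJ.encard_eq_eRk
  have hU3' : M.eRk (U : Set α) = 3 := by
    rw [hU.eRk_eq_encard, Set.encard_coe_eq_coe_finsetCard, hU3]; rfl
  have hAle : M.eRk (A : Set α) ≤ 3 := by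
    calc M.eRk (A : Set α) ≤ M.eRk (M.closure (U : Set α)) := M.eRk_mono hAcl
      _ = 3 := by rw [M.eRk_closure_eq, hU3']
  have hJncard : J.ncard ≤ 3 := by
    have h := hAle
    rw [← hJencard, ← hJfin.cast_ncard_eq] at h
    exact_mod_cast h
  have hJ3 : J.ncard = 3 := by
    by_contra hne
    rcases Nat.lt_or_ge J.ncard 2 with hlt | hge
    · -- `J` has `≤ 1` element: a circuit of `≤ 2` elements inside `A`
      obtain ⟨a, haA, haJ⟩ : ∃ a ∈ (A : Set α), a ∉ J := by
        by_contra h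
        push Not at h
        have hsub : (A : Set α) ⊆ J := fun a ha => h a ha
        have hle := Set.ncard_le_ncard hsub hJfin
        rw [Set.ncard_coe_finset, hA4] at hle
        omega
      have hacl : a ∈ M.closure J := hJ.subset_closure haA
      have hC := hJind.fundCircuit_isCircuit hacl haJ
      have h3 := hcirc _ hC
      have hle : (M.fundCircuit a J).encard ≤ (insert a J).encard :=
        Set.encard_le_encard (M.fundCircuit_subset_insert a J)
      have hins : (insert a J).encard ≤ 2 := by
        rw [Set.encard_insert_of_notMem haJ, ← hJfin.cast_ncard_eq]
        have h1 : J.ncard ≤ 1 := by omega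
        have h1' : (J.ncard : ℕ∞) ≤ 1 := by exact_mod_cast h1
        calc (J.ncard : ℕ∞) + 1 ≤ 1 + 1 := add_le_add_left h1' 1
          _ = 2 := by norm_num
      have : (3 : ℕ∞) ≤ 2 := h3.trans (hle.trans hins)
      exact absurd this (by norm_num)
    · -- `J` has `2` elements: `A` is a `4`-point line
      have h2 : J.ncard = 2 := by omega
      have hA2 : M.eRk (A : Set α) = 2 := by
        rw [← hJencard, ← hJfin.cast_ncard_eq, h2]; rfl
      have hle := hline _ hAE hA2
      rw [Set.ncard_coe_finset, hA4] at hle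
      omega
  have hJcl : J ⊆ M.closure (U : Set α) := hJA.trans hAcl
  have hJeRk : M.eRk (M.closure (U : Set α)) ≤ M.eRk J := by
    rw [M.eRk_closure_eq, hU3', hJind.eRk_eq_encard, ← hJfin.cast_ncard_eq, hJ3]; rfl
  have hJbasis : M.IsBasis J (M.closure (U : Set α)) :=
    hJind.isBasis_of_eRk_ge hJfin hJcl hJeRk (M.closure_subset_ground _)
  have hclJ : M.closure J = M.closure (U : Set α) := by
    rw [hJbasis.closure_eq_closure, M.closure_closure]
  calc (U : Set α) ⊆ M.closure (U : Set α) := M.subset_closure _ hU.subset_ground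
    _ = M.closure J := hclJ.symm
    _ ⊆ M.closure (A : Set α) := M.closure_subset_closure hJA

open scoped Classical in
/-- **THE TWO FAMILIES OF THE TRIPLE, COUNTED EXACTLY**: for a basis `I` of the rank-`q` set `B` (as a finset, `X = B ∖ I`),
the sets `I ∪ {e}` (`e ∈ X`) and `(I ∖ {z}) ∪ P` (`P` a pair of `X`, `z ∈ I` on the fundamental circuit of an element
of `P`) are `|X| + Σ_P |{z ∈ I : z ∈ C(e, I) for some e ∈ P}|` distinct spanning `(q+1)`-subsets of `B`, each
containing all of `I` but at most one element (p7's `card_spanF_ge_sq` / the triple, with the count kept). -/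
theorem exists_pair_families [M.Finite] (q : ℕ) (hq : 1 ≤ q) {B : Finset α} (hBq : M.eRk (B : Set α) = (q : ℕ∞))
    {I : Finset α} (hIind : M.Indep (I : Set α)) (hIB : I ⊆ B) (hIcard : I.card = q)
    (hBcl : (B : Set α) ⊆ M.closure (I : Set α)) :
    ∃ F : Finset (Set α), F ⊆ spanF M q B ∧
      F.card = (B \ I).card + ∑ P ∈ (B \ I).powersetCard 2,
        (I.filter (fun z => ∃ e ∈ P, z ∈ M.fundCircuit e (I : Set α))).card ∧
      ∀ D ∈ F, ∃ z₀, ∀ a ∈ I, a ≠ z₀ → a ∈ D := by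
  classical
  set X : Finset α := B \ I with hXdef
  have hXI : ∀ x ∈ X, x ∉ I := fun x hx => (Finset.mem_sdiff.1 hx).2
  have hXB : ∀ x ∈ X, x ∈ B := fun x hx => (Finset.mem_sdiff.1 hx).1
  have hXcl : ∀ x ∈ X, x ∈ M.closure (I : Set α) := fun x hx => hBcl (by exact_mod_cast hXB x hx)
  -- FAMILY 1: `I ∪ {x}`, `x ∈ X`
  set F₁ : Finset (Set α) := X.image (fun x => ((insert x I : Finset α) : Set α)) with hF₁
  have hF₁card : F₁.card = X.card := by
    rw [hF₁]
    apply Finset.card_image_of_injOn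
    intro x hx y hy hxy
    have hxy'' : (insert x I : Finset α) = insert y I := by
      simp only at hxy
      exact Finset.coe_inj.1 hxy
    have hx' : x ∈ (insert y I : Finset α) := hxy'' ▸ Finset.mem_insert_self x I
    rcases Finset.mem_insert.1 hx' with h | h
    · exact h
    · exact absurd h (hXI x hx)
  have hF₁sub : F₁ ⊆ spanF M q B := by
    intro D hD
    rw [hF₁, Finset.mem_image] at hD
    obtain ⟨x, hx, rfl⟩ := hD
    rw [mem_spanF]
    have hsubB : insert x I ⊆ B := Finset.insert_subset (hXB x hx) hIB
    have hcl : (B : Set α) ⊆ M.closure ((insert x I : Finset α) : Set α) := by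
      refine hBcl.trans (M.closure_subset_closure ?_)
      rw [Finset.coe_insert]; exact Set.subset_insert x _
    refine ⟨insert x I, hsubB, ?_, ?_, hcl, rfl⟩
    · rw [Finset.card_insert_of_notMem (hXI x hx), hIcard]
    · exact eRk_eq_of_subset_of_subset_closure (by exact_mod_cast hsubB) hBq hcl
  -- FAMILY 2: `(I ∖ {z}) ∪ P`, `P` a pair of `X`, `z ∈ I` on the fundamental circuit of an element of `P`
  set S : Finset (Σ _ : Finset α, α) :=
    (X.powersetCard 2).sigma (fun P => I.filter (fun z => ∃ x ∈ P, z ∈ M.fundCircuit x (I : Set α))) with hS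
  set g : (Σ _ : Finset α, α) → Set α := fun s => ((s.1 ∪ I.erase s.2 : Finset α) : Set α) with hg
  set F₂ : Finset (Set α) := S.image g with hF₂
  have hSdata : ∀ s ∈ S, s.1 ⊆ X ∧ s.1.card = 2 ∧ s.2 ∈ I ∧
      ∃ x ∈ s.1, s.2 ∈ M.fundCircuit x (I : Set α) := by
    intro s hs
    rw [hS, Finset.mem_sigma, Finset.mem_powersetCard, Finset.mem_filter] at hs
    exact ⟨hs.1.1, hs.1.2, hs.2.1, hs.2.2⟩
  have hsdiff : ∀ (P : Finset α) (z : α), P ⊆ X → (P ∪ I.erase z) \ I = P := by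
    intro P z hPX
    ext a
    simp only [Finset.mem_sdiff, Finset.mem_union, Finset.mem_erase]
    constructor
    · rintro ⟨h1 | h1, h2⟩
      · exact h1
      · exact absurd h1.2 h2
    · intro ha
      exact ⟨Or.inl ha, hXI a (hPX ha)⟩
  have hinter : ∀ (P : Finset α) (z : α), P ⊆ X → (P ∪ I.erase z) ∩ I = I.erase z := by
    intro P z hPX
    ext a
    simp only [Finset.mem_inter, Finset.mem_union, Finset.mem_erase]
    constructor
    · rintro ⟨h1 | h1, h2⟩
      · exact absurd h2 (hXI a (hPX h1))
      · exact h1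
    · intro ha
      exact ⟨Or.inr ha, ha.2⟩
  have hF₂card : F₂.card = S.card := by
    rw [hF₂]
    apply Finset.card_image_of_injOn
    intro s hs s' hs' h
    obtain ⟨hP, -, hz, -⟩ := hSdata s (by exact_mod_cast hs)
    obtain ⟨hP', -, hz', -⟩ := hSdata s' (by exact_mod_cast hs')
    have h' : (s.1 ∪ I.erase s.2 : Finset α) = s'.1 ∪ I.erase s'.2 := by
      have := h
      simp only [hg] at this
      exact_mod_cast this
    have hP1 : s.1 = s'.1 := by
      rw [← hsdiff s.1 s.2 hP, h', hsdiff s'.1 s'.2 hP']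
    have hE : I.erase s.2 = I.erase s'.2 := by
      rw [← hinter s.1 s.2 hP, h', hinter s'.1 s'.2 hP']
    have hz1 : s.2 = s'.2 := by
      by_contra hne
      have hmem : s.2 ∈ I.erase s'.2 := Finset.mem_erase.2 ⟨hne, hz⟩
      rw [← hE] at hmem
      exact Finset.notMem_erase s.2 I hmem
    exact Sigma.ext hP1 (heq_of_eq hz1)
  have hF₂sub : F₂ ⊆ spanF M q B := by
    intro D hD
    rw [hF₂, Finset.mem_image] at hD
    obtain ⟨s, hs, rfl⟩ := hD
    obtain ⟨hP, hP2, hz, x, hxP, hzC⟩ := hSdata s (by exact_mod_cast hs)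
    have hxX : x ∈ X := hP hxP
    have hxI : x ∉ I := hXI x hxX
    have hxcl : x ∈ M.closure (I : Set α) := hXcl x hxX
    have hC : M.IsCircuit (M.fundCircuit x (I : Set α)) :=
      hIind.fundCircuit_isCircuit hxcl (by simpa using hxI)
    have hCsub : M.fundCircuit x (I : Set α) ⊆ insert x (I : Set α) := M.fundCircuit_subset_insert x _
    have hzcl : s.2 ∈ M.closure ((insert x (I : Set α)) \ {s.2}) :=
      M.closure_subset_closure (Set.sdiff_subset_sdiff_left hCsub) (hC.mem_closure_sdiff_singleton_of_mem hzC)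
    have hcleq : M.closure ((insert x (I : Set α)) \ {s.2}) = M.closure (insert x (I : Set α)) :=
      M.closure_sdiff_singleton_eq_closure hzcl
    have hsubD : (insert x (I : Set α)) \ {s.2} ⊆ ((s.1 ∪ I.erase s.2 : Finset α) : Set α) := by
      intro a ha
      rw [Finset.coe_union, Finset.coe_erase]
      rcases ha.1 with h | h
      · exact Or.inl (by rw [h]; exact_mod_cast hxP)
      · exact Or.inr ⟨h, ha.2⟩
    have hcl : (B : Set α) ⊆ M.closure ((s.1 ∪ I.erase s.2 : Finset α) : Set α) := by
      calc (B : Set α) ⊆ M.closure (I : Set α) := hBcl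
        _ ⊆ M.closure (insert x (I : Set α)) := M.closure_subset_closure (Set.subset_insert x _)
        _ = M.closure ((insert x (I : Set α)) \ {s.2}) := hcleq.symm
        _ ⊆ M.closure ((s.1 ∪ I.erase s.2 : Finset α) : Set α) := M.closure_subset_closure hsubD
    have hsubB : s.1 ∪ I.erase s.2 ⊆ B :=
      Finset.union_subset (hP.trans (Finset.sdiff_subset)) ((Finset.erase_subset _ _).trans hIB)
    rw [mem_spanF]
    refine ⟨s.1 ∪ I.erase s.2, hsubB, ?_, ?_, hcl, rfl⟩
    · have hdisj : Disjoint s.1 (I.erase s.2) := by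
        rw [Finset.disjoint_left]
        intro a ha ha'
        exact hXI a (hP ha) (Finset.mem_erase.1 ha').2
      rw [Finset.card_union_of_disjoint hdisj, hP2, Finset.card_erase_of_mem hz, hIcard]
      omega
    · exact eRk_eq_of_subset_of_subset_closure (by exact_mod_cast hsubB) hBq hcl
  have hdisj₁₂ : Disjoint F₁ F₂ := by
    rw [Finset.disjoint_left]
    intro D hD1 hD2
    rw [hF₁, Finset.mem_image] at hD1
    rw [hF₂, Finset.mem_image] at hD2
    obtain ⟨x, hx, rfl⟩ := hD1
    obtain ⟨s, hs, hsD⟩ := hD2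
    obtain ⟨hP, -, hz, -⟩ := hSdata s (by exact_mod_cast hs)
    have h' : (s.1 ∪ I.erase s.2 : Finset α) = insert x I := by
      have := hsD
      simp only [hg] at this
      exact_mod_cast this
    have hzmem : s.2 ∈ s.1 ∪ I.erase s.2 := by
      rw [h']; exact Finset.mem_insert_of_mem hz
    rcases Finset.mem_union.1 hzmem with h | h
    · exact hXI _ (hP h) hz
    · exact Finset.notMem_erase s.2 I h
  refine ⟨F₁ ∪ F₂, Finset.union_subset hF₁sub hF₂sub, ?_, ?_⟩
  · rw [Finset.card_union_of_disjoint hdisj₁₂, hF₁card, hF₂card, hS, Finset.card_sigma]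
  · intro D hD
    rcases Finset.mem_union.1 hD with hD1 | hD2
    · rw [hF₁, Finset.mem_image] at hD1
      obtain ⟨e, -, rfl⟩ := hD1
      exact ⟨e, fun a haI _ => by rw [Finset.coe_insert]; exact Set.mem_insert_of_mem _ (by exact_mod_cast haI)⟩
    · rw [hF₂, Finset.mem_image] at hD2
      obtain ⟨s, -, rfl⟩ := hD2
      refine ⟨s.2, fun a haI has => ?_⟩
      simp only [hg, Finset.coe_union, Finset.coe_erase, Set.mem_union, Finset.mem_coe, Set.mem_sdiff,
        Set.mem_singleton_iff]
      exact Or.inr ⟨haI, has⟩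

open scoped Classical in
/-- **THE PLANE FAMILY**: `I` a basis of the rank-`q` set `B` with `|B ∖ I| = 3`, `U ⊆ I` of `3` elements with
`B ∖ I ⊆ cl(U)`; the `C(6, 4) = 15` sets `(I ∖ U) ∪ A`, `A` a `4`-subset of the `6`-point plane `U ∪ (B ∖ I)`, are
distinct spanning `(q+1)`-subsets of `B` (`subset_closure_of_four_subset`). -/
theorem exists_plane_family [M.Finite] (q : ℕ) (hcirc : ∀ C, M.IsCircuit C → 3 ≤ C.encard)
    (hline : ∀ L ⊆ M.E, M.eRk L = 2 → L.ncard ≤ 3)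
    {B : Finset α} (hBE : (B : Set α) ⊆ M.E) (hBq : M.eRk (B : Set α) = (q : ℕ∞))
    {I : Finset α} (hIind : M.Indep (I : Set α)) (hIB : I ⊆ B) (hIcard : I.card = q)
    (hBcl : (B : Set α) ⊆ M.closure (I : Set α)) (hX3 : (B \ I).card = 3)
    {U : Finset α} (hUI : U ⊆ I) (hU3 : U.card = 3)
    (hXclU : ((B \ I : Finset α) : Set α) ⊆ M.closure (U : Set α)) :
    ∃ F : Finset (Set α), F.card = 15 ∧ F ⊆ spanF M q B := by
  classical
  set X : Finset α := B \ I with hXdef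
  have hXI : ∀ x ∈ X, x ∉ I := fun x hx => (Finset.mem_sdiff.1 hx).2
  have hUind : M.Indep (U : Set α) := hIind.subset (by exact_mod_cast hUI)
  set W : Finset α := U ∪ X with hWdef
  have hWB : W ⊆ B := Finset.union_subset (hUI.trans hIB) Finset.sdiff_subset
  have hWE : (W : Set α) ⊆ M.E := (Finset.coe_subset.2 hWB).trans hBE
  have hWcl : (W : Set α) ⊆ M.closure (U : Set α) := by
    rw [hWdef, Finset.coe_union]
    exact Set.union_subset (M.subset_closure _ hUind.subset_ground) hXclU
  have hUX : Disjoint U X := by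
    rw [Finset.disjoint_left]
    intro a haU haX
    exact hXI a haX (hUI haU)
  have hW6 : W.card = 6 := by
    rw [hWdef, Finset.card_union_of_disjoint hUX, hU3, hX3]
  have hIUX : Disjoint (I \ U) W := by
    rw [hWdef, Finset.disjoint_union_right]
    refine ⟨Finset.sdiff_disjoint, ?_⟩
    rw [Finset.disjoint_left]
    intro a ha haX
    exact hXI a haX (Finset.mem_sdiff.1 ha).1
  set FA : Finset (Set α) := (W.powersetCard 4).image (fun A => (((I \ U) ∪ A : Finset α) : Set α)) with hFA
  have hFAcard : FA.card = 15 := by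
    rw [hFA]
    rw [Finset.card_image_of_injOn]
    · rw [Finset.card_powersetCard, hW6]; rfl
    · intro A hA A' hA' hAA'
      have hAW : A ⊆ W := (Finset.mem_powersetCard.1 (by exact_mod_cast hA)).1
      have hA'W : A' ⊆ W := (Finset.mem_powersetCard.1 (by exact_mod_cast hA')).1
      have heq : ((I \ U) ∪ A : Finset α) = (I \ U) ∪ A' := by
        simp only at hAA'
        exact Finset.coe_inj.1 hAA'
      have hkey : ∀ A₀ : Finset α, A₀ ⊆ W → ((I \ U) ∪ A₀) ∩ W = A₀ := by
        intro A₀ hA₀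
        rw [Finset.union_inter_distrib_right, Finset.disjoint_iff_inter_eq_empty.1 hIUX, Finset.empty_union,
          Finset.inter_eq_left.2 hA₀]
      rw [← hkey A hAW, heq, hkey A' hA'W]
  have hFAsub : FA ⊆ spanF M q B := by
    intro D hD
    rw [hFA, Finset.mem_image] at hD
    obtain ⟨A, hA, rfl⟩ := hD
    rw [Finset.mem_powersetCard] at hA
    have hUcl : (U : Set α) ⊆ M.closure (A : Set α) :=
      subset_closure_of_four_subset hcirc hline hUind hU3 hWE hWcl hA.1 hA.2
    have hIcl : (I : Set α) ⊆ M.closure (((I \ U) ∪ A : Finset α) : Set α) := by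
      intro a haI
      by_cases haU : a ∈ U
      · exact M.closure_subset_closure (by rw [Finset.coe_union]; exact Set.subset_union_right) (hUcl haU)
      · refine M.subset_closure _ ?_ ?_
        · exact (Finset.coe_subset.2 (Finset.union_subset (Finset.sdiff_subset.trans hIB)
            (hA.1.trans hWB))).trans hBE
        · rw [Finset.coe_union]
          exact Or.inl (by rw [Finset.mem_coe, Finset.mem_sdiff]; exact ⟨by exact_mod_cast haI, haU⟩)
    have hcl : (B : Set α) ⊆ M.closure (((I \ U) ∪ A : Finset α) : Set α) :=
      hBcl.trans (M.closure_subset_closure_of_subset_closure hIcl)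
    have hsubB : (I \ U) ∪ A ⊆ B := Finset.union_subset (Finset.sdiff_subset.trans hIB) (hA.1.trans hWB)
    rw [mem_spanF]
    refine ⟨(I \ U) ∪ A, hsubB, ?_, ?_, hcl, rfl⟩
    · have hdisjA : Disjoint (I \ U) A := Finset.disjoint_of_subset_right hA.1 hIUX
      rw [Finset.card_union_of_disjoint hdisjA, Finset.card_sdiff, Finset.inter_eq_left.2 hUI, hU3, hIcard,
        hA.2]
      have hq3 : 3 ≤ q := by rw [← hIcard, ← hU3]; exact Finset.card_le_card hUI
      omega
    · exact eRk_eq_of_subset_of_subset_closure (by exact_mod_cast hsubB) hBq hcl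
  exact ⟨FA, hFAcard, hFAsub⟩

end S2

end PercRepro
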